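import Mathlib
import Literature.RingTheory.LocalCohomology.CechFiniteness

/-!
# The Čech complex commutes with localisation of the module: torsion of `H²` passes to `T⁻¹M`

Route `SkinnerWilesDefectOne`, crux `ReducibleOrdinaryProModular` (stmt-Langlands-12919), line
`fine-selmer-codimension-two`, stub (R) `stub_raynaudConnectedness` = Grothendieck's connectedness
theorem [SGA 2 XIII 2.1], sub-goal (H2a) of the lead's (c3) Čech-complex programme.  For a commutative
ring `A`, `y : Fin s → A`, an `A`-module `M` and a localisation `g : M → M' = T⁻¹M` (Mathlib's
characteristic predicate `IsLocalizedModule T g`), the ordered Čech complex `Č(y; -)` of the tree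
(`Literature/RingTheory/LocalCohomology/Cech*.lean`) satisfies "`Č(y; T⁻¹M) = T⁻¹ Č(y; M)`":

* `Theorems.isLocalizedModule_locMap` — the induced map `M_{y_t} → M'_{y_t}` (the tree's
  `locMap y g t`) is again a localisation at `T`: localising at `T` and at the powers of `y_t` commute
  (fraction calculus with Mathlib's `LocalizedModule.mk_eq`);
* `Theorems.isLocalizedModule_cechObjMap` — hence so is `Č^n(y; M) → Č^n(y; M')` (localisation
  commutes with finite products, Mathlib's `IsLocalizedModule.pi`);
* `Theorems.smul_H2_eq_zero_of_isLocalizedModule` — consequently, if an ideal `J` kills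
  `H²(y; M) = Z¹/B¹` (`CechFiniteness.lean`) then it kills `H²(y; M')`: a cocycle `z'` of `M'` has
  `u z' = g(z)` with `u ∈ T` and `u' z` a cocycle of `M` (`u' ∈ T`); from `r u' z = d w` we get
  `u' u · r z' = d g(w)`, and `u' u ∈ T` acts bijectively on the cochains of `M'`, so `r z' = d w'`.

Registered sub-goal of this file: `stub_raynaudConnectedness_auxCechLocalization` (§3), the last
statement at universe `0` with the registered binders verbatim.  No definitions are introduced; no
named facts are used.

References: A. Grothendieck, SGA 2, Exp. II (le complexe de Čech et la localisation), Exp. XIII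
Thm. 2.1 [Grothendieck1968SGA2]; D. Eisenbud, *The Geometry of Syzygies*, GTM 229, App. 1, Thm. A1.3
[Eisenbud2005]; The Stacks Project, Tag 01FG [StacksProject].
-/

set_option linter.dupNamespace false -- project-wide option (lakefile weak.linter.dupNamespace); `Summit.Langlands.Langlands` is the mandated namespace
set_option autoImplicit false

noncomputable section

namespace Summit.Langlands.Langlands.Theorems

open Literature.RingTheory.LocalCohomology

universe u

variable {A : Type u} [CommRing A] {s : ℕ} (y : Fin s → A)
variable {M : Type u} [AddCommGroup M] [Module A M] {M' : Type u} [AddCommGroup M'] [Module A M']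

/-! ## 1. Localisation at `T` commutes with `(-)_{y_t}` and with `Č^n(y; -)` -/

section Commute

variable (T : Submonoid A) (g : M →ₗ[A] M') [IsLocalizedModule T g]

/-- Multiplication by `a ∈ A` on `M'_{y_t}` is the localisation of multiplication by `a` on `M'`.
[folklore] -/
theorem algebraMap_end_cechLoc_eq_locMap {n : ℕ} (t : Fin n → Fin s) (a : A) :
    algebraMap A (Module.End A (CechLoc y M' t)) a =
      locMap y (algebraMap A (Module.End A M') a) t := by
  simp only [Module.algebraMap_end_eq_smul_id, locMap, map_smul, IsLocalizedModule.map_id]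

/-- **Localisations commute**: if `g : M → M'` is a localisation at `T`, so is the induced map
`M_{y_t} → M'_{y_t}` (both are the localisation of `M` at `T · y_t^ℕ`). [folklore] -/
theorem isLocalizedModule_locMap {n : ℕ} (t : Fin n → Fin s) :
    IsLocalizedModule T (locMap y g t) where
  map_units u := by
    have hu := (Module.End.isUnit_iff _).mp (IsLocalizedModule.map_units g u)
    rw [Module.End.isUnit_iff, algebraMap_end_cechLoc_eq_locMap]
    exact ⟨locMap_injective y _ hu.1 t, locMap_surjective y _ hu.2 t⟩
  surj z := by
    induction z using LocalizedModule.induction_on with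
    | h m' p =>
      obtain ⟨⟨m, u⟩, hu⟩ := IsLocalizedModule.surj T g m'
      dsimp only at hu
      refine ⟨⟨LocalizedModule.mk m p, u⟩, ?_⟩
      dsimp only
      rw [locMap_mk, ← hu, Submonoid.smul_def, Submonoid.smul_def, LocalizedModule.smul'_mk]
  exists_of_eq {z₁ z₂} h := by
    induction z₁ using LocalizedModule.induction_on with
    | h m₁ p₁ =>
    induction z₂ using LocalizedModule.induction_on with
    | h m₂ p₂ =>
      rw [locMap_mk, locMap_mk, LocalizedModule.mk_eq] at h
      obtain ⟨q, hq⟩ := h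
      have h' : g ((q : A) • (p₂ : A) • m₁) = g ((q : A) • (p₁ : A) • m₂) := by
        simpa only [map_smul, Submonoid.smul_def] using hq
      obtain ⟨c, hc⟩ := IsLocalizedModule.exists_of_eq (S := T) (f := g) h'
      refine ⟨c, ?_⟩
      rw [Submonoid.smul_def, Submonoid.smul_def, LocalizedModule.smul'_mk,
        LocalizedModule.smul'_mk, LocalizedModule.mk_eq]
      refine ⟨q, ?_⟩
      simp only [Submonoid.smul_def, smul_smul] at hc ⊢
      convert hc using 2 <;> ring

/-- **`Č^n(y; -)` commutes with localisation of the module**: `Č^n(y; M) → Č^n(y; T⁻¹M)` is a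
localisation at `T` (a finite product of the localisations `isLocalizedModule_locMap`, Mathlib's
`IsLocalizedModule.pi`). [folklore] -/
theorem isLocalizedModule_cechObjMap (n : ℕ) : IsLocalizedModule T (cechObjMap y g n) := by
  haveI := fun t : Fin (n + 1) → Fin s => isLocalizedModule_locMap y T g t
  exact IsLocalizedModule.pi T fun t : Fin (n + 1) → Fin s => locMap y g t

end Commute

/-! ## 2. Torsion of `H²` passes to the localised module -/

/-- **If `J` kills `H²(y; M)` then `J` kills `H²(y; T⁻¹M)`.**  For a cocycle `z'` of `M'`:
`u z' = g(z)` (`u ∈ T`), `g(d z) = u d z' = 0` so `u' d z = 0` (`u' ∈ T`) and `ζ = u' z` is a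
cocycle of `M`; `r ζ = d w` by hypothesis, whence `u' u · r z' = g(r ζ) = d g(w)`; writing
`g(w) = u' u · w'` (the elements of `T` act bijectively on `Č⁰(y; M')`) and cancelling `u' u` on
`Č¹(y; M')` gives `r z' = d w'`. [folklore] -/
theorem smul_H2_eq_zero_of_isLocalizedModule (T : Submonoid A) (g : M →ₗ[A] M')
    [IsLocalizedModule T g] (J : Ideal A) (hM : ∀ c : H2 (y := y) (M := M), ∀ r ∈ J, r • c = 0)
    (c : H2 (y := y) (M := M')) (r : A) (hr : r ∈ J) : r • c = 0 := by
  haveI := fun n => isLocalizedModule_cechObjMap y T g n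
  obtain ⟨⟨z', hz'⟩, rfl⟩ := Submodule.Quotient.mk_surjective _ c
  have hdz' : dC 1 z' = 0 := LinearMap.mem_ker.mp hz'
  -- (a) `u • z' = g z`
  obtain ⟨⟨z, u⟩, hu⟩ := IsLocalizedModule.surj T (cechObjMap y g 1) z'
  dsimp only at hu
  -- (b) `g (dC 1 z) = 0`, so `u' • dC 1 z = 0`
  have h2 : cechObjMap y g 2 (dC 1 z) = 0 := by
    rw [← dC_cechObjMap, ← hu, Submonoid.smul_def, map_smul, hdz', smul_zero]
  obtain ⟨u', hu'⟩ := (IsLocalizedModule.eq_zero_iff T (cechObjMap y g 2)).mp h2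
  -- the cocycle `ζ = u' • z` of `M`
  have hζ : dC 1 ((u' : A) • z) = 0 := by
    rw [map_smul, ← Submonoid.smul_def, hu']
  -- hypothesis: `r • [ζ] = 0`, i.e. `r • ζ = dC 0 w`
  have h0 := hM (H2.mk ((u' : A) • z) hζ) r hr
  change (B1 (y := y) (M := M)).mkQ (r • ⟨(u' : A) • z, hζ⟩) = 0 at h0
  rw [Submodule.mkQ_apply, Submodule.Quotient.mk_eq_zero] at h0
  simp only [B1, Submodule.mem_comap, Submodule.coe_subtype, LinearMap.mem_range,
    Submodule.coe_smul] at h0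
  obtain ⟨w, hw⟩ := h0
  -- apply `g`: `(u' u) • r • z' = dC 0 (g w)`
  have key : ((u' * u : T) : A) • r • z' = dC 0 (cechObjMap y g 0 w) := by
    rw [dC_cechObjMap, hw, map_smul, map_smul, ← hu, Submonoid.smul_def, Submonoid.coe_mul]
    simp only [smul_smul]
    congr 1
    ring
  -- `u' u ∈ T` acts bijectively on the cochains of `M'`
  obtain ⟨w', hw'⟩ := ((Module.End.isUnit_iff _).mp
    (IsLocalizedModule.map_units (cechObjMap y g 0) (u' * u))).2 (cechObjMap y g 0 w)
  rw [Module.algebraMap_end_apply] at hw'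
  have key' : r • z' = dC 0 w' := by
    apply IsLocalizedModule.smul_injective (cechObjMap y g 1) (u' * u)
    dsimp only
    rw [Submonoid.smul_def, Submonoid.smul_def, key, ← hw', map_smul]
  -- conclude
  change (B1 (y := y) (M := M')).mkQ (r • ⟨z', hz'⟩) = 0
  rw [Submodule.mkQ_apply, Submodule.Quotient.mk_eq_zero]
  simp only [B1, Submodule.mem_comap, Submodule.coe_subtype, LinearMap.mem_range,
    Submodule.coe_smul]
  exact ⟨w', key'.symm⟩

end Summit.Langlands.Langlands.Theorems

/-! ## 3. The registered sub-goal (verbatim signature) -/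

namespace Summit.Langlands.Langlands.Cruxes.ReducibleOrdinaryProModular.FineSelmerCodimensionTwo

/-- **Registered sub-goal `stub_raynaudConnectedness_auxCechLocalization` of stub (R)
`stub_raynaudConnectedness`** (c3, SGA 2 XIII 2.1 programme, step (H2a)): the Čech complex commutes
with localisation of the module, in torsion form — if an ideal `J` kills `H²(y; M)` then it kills
`H²(y; T⁻¹M)`; `Theorems.smul_H2_eq_zero_of_isLocalizedModule` at universe `0`.
[cite: Grothendieck1968SGA2, Exp. II] -/
theorem stub_raynaudConnectedness_auxCechLocalization : ∀ (A : Type) [CommRing A] (s : ℕ) (y : Fin s → A) (M : Type) [AddCommGroup M] [Module A M] (M' : Type) [AddCommGroup M'] [Module A M'] (T : Submonoid A) (g : M →ₗ[A] M') [IsLocalizedModule T g] (J : Ideal A), (∀ c : Literature.RingTheory.LocalCohomology.H2 (y := y) (M := M), ∀ r ∈ J, r • c = 0) → ∀ c : Literature.RingTheory.LocalCohomology.H2 (y := y) (M := M'), ∀ r ∈ J, r • c = 0 :=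
  fun _A _ _s y _M _ _ _M' _ _ T g _ J hM c r hr =>
    Summit.Langlands.Langlands.Theorems.smul_H2_eq_zero_of_isLocalizedModule y T g J hM c r hr

end Summit.Langlands.Langlands.Cruxes.ReducibleOrdinaryProModular.FineSelmerCodimensionTwo

end
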